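import Summits.ResolutionOfSingularities.ResolutionOfSingularities.Theorems.FrobeniusLadderFRationalResolutionGaloisIdealDescent
import Summits.ResolutionOfSingularities.ResolutionOfSingularities.Theorems.FrobeniusLadderFRationalResolutionChartHloc
import Summits.ResolutionOfSingularities.ResolutionOfSingularities.Theorems.FrobeniusLadderFRationalResolutionIsolatedGlue
import Mathlib.RingTheory.Flat.FaithfullyFlat.Algebra
import Mathlib.RingTheory.FiniteStability
import HarnessLib

/-!
# Crux `FrobeniusLadder.FRationalResolution` (stmt-ResolutionOfSingularities-15317), line `redirect`,
# stub `stub_diagonalizableQuotientResolution` — resolution at an isolated singular point from a GALOIS-STABLE centre on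
# the base change `B ⊗_K K'` (scheme side of the Galois route to the twisted isolated case)

`…ChartHloc.hloc_of_flat_chart` (✓) resolves an isolated singular point `ι 𝔭` from a flat finitely presented chart `B → C`
whose image contains `𝔭` and a `𝔭`-primary `I ⊆ B` with `Bl_{IC}(Spec C)` regular. For the chart `C := B ⊗_K K'`
(`K'/K` finite Galois — the base change splitting the residue data of a twisted quotient chart point) a centre built
UPSTAIRS, `J ⊆ B ⊗_K K'`, descends as soon as it is stable under the Galois twists `1 ⊗ σ`
(`…GaloisIdealDescent.eq_map_comap_of_forall_map_mem` ✓): `J = (J ∩ B)(B ⊗_K K')`. This file is the scheme-side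
packaging:

* `le_of_pow_le_of_ne_top` — bookkeeping: `𝔭ⁿ ≤ I ≠ ⊤`, `𝔭` maximal ⇒ `I ≤ 𝔭`;
* `hloc_of_galois_stable_centre` — **`hloc` at the isolated singular point `ι 𝔭` from a Galois-stable `J ⊆ B ⊗_K K'` with
  `𝔭ⁿ(B ⊗_K K') ⊆ J ≠ ⊤` and `Bl_J Spec(B ⊗_K K')` regular** (`B ⊗_K K'` is free, hence faithfully flat and finitely
  presented over `B`; `𝔭` is hit by `Spec(B ⊗_K K') → Spec B`);
* **`hasResolution_of_galois_stable_centres`** — an integral `X` locally of finite type over any field `K` whose finitely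
  many singular points all carry such data has a resolution of singularities (`…IsolatedGlue`).

Honest label: plumbing + assembly for the Galois route (no stub closed by name). What is NOT here: producing, at a twisted
isolated quotient chart point, the Galois extension `K'` and a Galois-STABLE centre with regular blow-up on `X_{K'}` — the
decomposition group of a point `x'` over `x` permutes the trivial-residue chart points over `x'`, so stability needs the
comparison of two chart structures at one point (memo MEMO-15317-leafhand4-g7 §3). No definitions, no named facts, no sorry.
[folklore; cite: KMRT1998, (18.1)] [cite: StacksProject, Tag 0CDQ] [cite: Kollar2007, §2.2]
-/

noncomputable section

-- single-problem summit: the doubled namespace component is forced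
set_option linter.dupNamespace false

open CategoryTheory AlgebraicGeometry TopologicalSpace TensorProduct
open Literature.AlgebraicGeometry.Resolution
open Summit.ResolutionOfSingularities.ResolutionOfSingularities.Theorems.FRationalResolution

namespace Summit.ResolutionOfSingularities.ResolutionOfSingularities.Theorems.FRationalResolution.GaloisStableCentre

/-- Bookkeeping: an ideal `I ≠ ⊤` containing a power of a maximal ideal `𝔭` is contained in `𝔭`. [folklore] -/
theorem le_of_pow_le_of_ne_top {B : Type} [CommRing B] (𝔭 I : Ideal B) [h𝔭 : 𝔭.IsMaximal] {n : ℕ}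
    (hpI : 𝔭 ^ n ≤ I) (hI : I ≠ ⊤) : I ≤ 𝔭 := by
  obtain ⟨𝔪, h𝔪, hI𝔪⟩ := Ideal.exists_le_maximal I hI
  haveI := h𝔪.isPrime
  have h𝔭𝔪 : 𝔭 ≤ 𝔪 := Ideal.IsPrime.le_of_pow_le (hpI.trans hI𝔪)
  rwa [← h𝔭.eq_of_le h𝔪.ne_top h𝔭𝔪] at hI𝔪

/-- **`hloc` at an isolated singular point from a GALOIS-STABLE centre on the base change.** Data: `ι : Spec B → X` an
affine open over `K` (`B` a domain of finite type over `K`, `X` integral locally of finite type), `𝔭 ⊆ B` maximal `≠ 0`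
with `ι 𝔭` singular and every other point of `Spec B` regular; `K'/K` finite Galois; `J ⊆ B ⊗_K K'` with
`𝔭ⁿ (B ⊗_K K') ⊆ J ≠ ⊤`, stable under every twist `1 ⊗ σ`, `σ ∈ Gal(K'/K)`, and with `Bl_J Spec(B ⊗_K K')` regular.
Then `ι 𝔭` has an open neighbourhood `V` without other singular points and a proper `ρ : Y → V`, `Y` regular, an
isomorphism over `V ∩ Reg X` with dense preimage. [folklore; cite: KMRT1998, (18.1)] [cite: Kollar2007, §2.2] -/
theorem hloc_of_galois_stable_centre (K : Type) [Field K] (X : Scheme.{0}) [IsIntegral X]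
    (f : X ⟶ Spec (.of K)) [LocallyOfFiniteType f]
    {B : Type} [CommRing B] [IsDomain B] [Algebra K B] [Algebra.FiniteType K B]
    (ι : Spec (.of B) ⟶ X) [IsOpenImmersion ι] (hι : ι ≫ f = Spec.map (CommRingCat.ofHom (algebraMap K B)))
    (𝔭 : Ideal B) [h𝔭 : 𝔭.IsMaximal] (h𝔭0 : 𝔭 ≠ ⊥)
    (hsing : ι ⟨𝔭, h𝔭.isPrime⟩ ∉ Scheme.regularLocus X)
    (hregB : ∀ P : Spec (.of B), P.asIdeal ≠ 𝔭 → P ∈ Scheme.regularLocus (Spec (.of B)))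
    (K' : Type) [Field K'] [Algebra K K'] [FiniteDimensional K K'] [IsGalois K K']
    (J : Ideal (B ⊗[K] K')) {n : ℕ} (hpJ : (𝔭 ^ n).map (algebraMap B (B ⊗[K] K')) ≤ J) (hJ : J ≠ ⊤)
    (hGal : ∀ σ : K' ≃ₐ[K] K', ∀ x ∈ J, Algebra.TensorProduct.map (AlgHom.id B B) (σ : K' →ₐ[K] K') x ∈ J)
    (hregJ : Scheme.IsRegular (affineBlowup J)) :
    ∃ (V : X.Opens), ι ⟨𝔭, h𝔭.isPrime⟩ ∈ V ∧
      (∀ t : X, t ∉ Scheme.regularLocus X → t ∈ V → t = ι ⟨𝔭, h𝔭.isPrime⟩) ∧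
      ∃ (Y : Scheme.{0}) (ρ : Y ⟶ V), IsProper ρ ∧ Scheme.IsRegular Y ∧
        IsIso (ρ ∣_ (V.ι ⁻¹ᵁ ⟨Scheme.regularLocus X, isOpen_regularLocus_of_locallyOfFiniteType_field f⟩)) ∧
        Dense ((ρ ⁻¹ᵁ (V.ι ⁻¹ᵁ ⟨Scheme.regularLocus X,
          isOpen_regularLocus_of_locallyOfFiniteType_field f⟩) : Y.Opens) : Set Y) := by
  haveI : IsNoetherianRing B := Algebra.FiniteType.isNoetherianRing K B
  haveI : Algebra.FinitePresentation K K' := (Algebra.FinitePresentation.of_finiteType (R := K) (A := K')).mp inferInstance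
  haveI : Algebra.FinitePresentation B (B ⊗[K] K') := inferInstance
  haveI : Module.FaithfullyFlat B (B ⊗[K] K') := inferInstance
  -- the descended centre
  set I : Ideal B := J.comap (algebraMap B (B ⊗[K] K')) with hIdef
  have hIJ : I.map (algebraMap B (B ⊗[K] K')) = J :=
    (GaloisIdealDescent.eq_map_comap_of_forall_map_mem J hGal).symm
  have hpI : 𝔭 ^ n ≤ I := Ideal.le_comap_of_map_le hpJ
  have hItop : I ≠ ⊤ := by
    intro h
    apply hJ
    rw [← hIJ, h, Ideal.map_top]
  have hIp : I ≤ 𝔭 := le_of_pow_le_of_ne_top 𝔭 I hpI hItop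
  have hI0 : I ≠ ⊥ := by
    intro h0
    have : 𝔭 ^ n = ⊥ := le_bot_iff.mp (h0 ▸ hpI)
    exact pow_ne_zero n h𝔭0 this
  -- `𝔭` is hit by the faithfully flat chart
  have h𝔭C : (⟨𝔭, h𝔭.isPrime⟩ : PrimeSpectrum B) ∈
      Set.range (PrimeSpectrum.comap (algebraMap B (B ⊗[K] K'))) :=
    PrimeSpectrum.comap_surjective_of_faithfullyFlat (B := B ⊗[K] K') _
  have hregC : Scheme.IsRegular (affineBlowup (I.map (algebraMap B (B ⊗[K] K')))) := by
    rw [hIJ]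
    exact hregJ
  have hsingB : (⟨𝔭, h𝔭.isPrime⟩ : Spec (.of B)) ∉ Scheme.regularLocus (Spec (.of B)) :=
    fun hreg => hsing ((mem_regularLocus_iff_of_flat_of_isPreimmersion ι _).mp hreg)
  exact ChartHloc.hloc_of_flat_chart K X f (C := B ⊗[K] K') ι hι 𝔭 I (IsNoetherian.noetherian I) hI0 hpI hIp h𝔭C
    hregC hsingB hregB

/-- **RESOLUTION FROM GALOIS-STABLE CENTRES ON BASE CHANGES (Galois route, scheme side).** Let `X` be an integral `K`-scheme
locally of finite type (any field `K`) with finitely many singular points, each the image `ι 𝔭` of a maximal ideal `≠ 0` of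
an affine open `Spec B ↪ X` (`Spec B ∖ {𝔭}` regular) for which some finite Galois extension `K'/K` and some ideal
`J ⊆ B ⊗_K K'` satisfy: `𝔭ⁿ(B ⊗_K K') ⊆ J ≠ ⊤`, `J` is stable under the Galois twists `1 ⊗ σ`, and `Bl_J Spec(B ⊗_K K')` is
regular. Then `X` has a resolution of singularities. [folklore; cite: KMRT1998, (18.1)] [cite: Kollar2007, §2.2] -/
theorem hasResolution_of_galois_stable_centres (K : Type) [Field K] (X : Scheme.{0}) [IsIntegral X]
    (f : X ⟶ Spec (.of K)) [LocallyOfFiniteType f] (hfin : (Scheme.regularLocus X)ᶜ.Finite)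
    (hchart : ∀ s : X, s ∉ Scheme.regularLocus X →
      ∃ (B : Type) (_ : CommRing B) (_ : IsDomain B) (_ : Algebra K B) (_ : Algebra.FiniteType K B)
        (ι : Spec (.of B) ⟶ X) (_ : IsOpenImmersion ι)
        (_ : ι ≫ f = Spec.map (CommRingCat.ofHom (algebraMap K B)))
        (𝔭 : Ideal B) (h𝔭 : 𝔭.IsMaximal) (_ : 𝔭 ≠ ⊥) (_ : ι ⟨𝔭, h𝔭.isPrime⟩ = s)
        (_ : ∀ P : Spec (.of B), P.asIdeal ≠ 𝔭 → P ∈ Scheme.regularLocus (Spec (.of B)))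
        (K' : Type) (_ : Field K') (_ : Algebra K K') (_ : FiniteDimensional K K') (_ : IsGalois K K')
        (J : Ideal (B ⊗[K] K')) (n : ℕ),
          (𝔭 ^ n).map (algebraMap B (B ⊗[K] K')) ≤ J ∧ J ≠ ⊤ ∧
          (∀ σ : K' ≃ₐ[K] K', ∀ x ∈ J, Algebra.TensorProduct.map (AlgHom.id B B) (σ : K' →ₐ[K] K') x ∈ J) ∧
          Scheme.IsRegular (affineBlowup J)) :
    Scheme.HasResolution X := by
  refine IsolatedGlue.hasResolution_of_finite_singularLocus_of_local K X f hfin fun s hs => ?_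
  obtain ⟨B, _, _, _, _, ι, _, hι, 𝔭, h𝔭, h𝔭0, hιs, hregB, K', _, _, _, _, J, n, hpJ, hJ, hGal, hregJ⟩ := hchart s hs
  subst hιs
  exact hloc_of_galois_stable_centre K X f ι hι 𝔭 h𝔭0 hs hregB K' J hpJ hJ hGal hregJ

end Summit.ResolutionOfSingularities.ResolutionOfSingularities.Theorems.FRationalResolution.GaloisStableCentre

end
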